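import Summits.BirchSwinnertonDyer.Rank1Residual.X2.GreenbergSelmerCountMultiplicative
import Summits.BirchSwinnertonDyer.Rank1Residual.X2.CongruentLambdaShiftDerived
import HarnessLib

/-!
# Route G's typed input `CongruentLambdaShift` DERIVED for pairs with a MULTIPLICATIVE member:
# `λ(E₁) + Σδ(E₁) + e_p(E₁) = λ(E₂) + Σδ(E₂) + e_p(E₂)` and the `μ`-transfer, for `E₁[p] ≅ E₂[p]`,
# one or both of `E₁`, `E₂` having `p ‖ N` (Greenberg–Vatsal's Thm. (1.4) mechanism at `p ‖ N`)

HONEST FRAMING (cell `b2b-bsdres`, run/shared/lean/b2b/bsd-rank1-residual/, verbatim in every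
file): the goal of the cell is to DELETE the COMBINATION-SHAPED residual classes of the
Birch–Swinnerton-Dyer formula for ALL analytic-rank `≤ 1` elliptic curves over `ℚ` — "full BSD
formula for every rank `≤ 1` curve in class `C`" assembled STRICTLY from published theorems — so
that the rank-`≤ 1` remainder becomes exactly the CONSTRUCTION-SHAPED classes, which are TYPED
(missing-input `Prop`s), NOT attempted. This is not "finishing BSD". Sub-cell
`b2b-bsdres-eisenstein-p2` (CLASS-OWNERS row "X2"), gen 13: research route; NO CLAIM BEYOND STATED
CLASSES; nothing here changes a label. Theorems only; axioms standard; no `sorry`.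

WHAT THIS FILE PROVES (step K-D2; X2-GAP §12 route G at `p ‖ N`, §16.6 successor programme DONE).
Gen 11 (`CongruentLambdaShiftDerived`) derived eisenstein-p1's typed route-G input
`X1.CongruenceTransfer.CongruentLambdaShift` for two GOOD-ORDINARY members. Here the MIXED pairs
(`E₁` with `p ‖ N₁` — the X2 member —, `E₂` good ordinary at `p` — e.g. the anomalous X1 partner;
16 820 such census predictions at `p = 3`, 0 violations, X2-GAP §12.3) and the MULT–MULT pairs:
for `E₁, E₂/ℚ` globally minimal, `p` ODD, `Σ₀ ∌ p` containing the bad primes `≠ p` of both,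
`TorsionIso E₁ E₂ p`, cyclotomic data, f.g. torsion dual data (Kato):
* `mu_eq_zero_mult_of_goodOrd` / `mu_eq_zero_goodOrd_of_mult` / `mu_eq_zero_mult_of_mult` — the
  `μ`-transfer in every direction (GV p. 27 "if `μ_{E₁} = 0` then `μ_{E₂} = 0`");
* **`lambda_add_eq_mult_goodOrd`**: `λ₁ + Σδ₁ + e_p(E₁) = λ₂ + Σδ₂` (`e_p = 1` split, `0` non-split);
  **`lambda_add_eq_mult_mult`**: `λ₁ + Σδ₁ + e_p(E₁) = λ₂ + Σδ₂ + e_p(E₂)`;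
* **`congruentLambdaShift_mult_goodOrd_of_facts`**, **`…_goodOrd_mult_of_facts`**,
  **`…_mult_mult_of_facts`**: `CongruentLambdaShift W₁ W₂ p e` with the EXPLICIT shift
  `e = Σ_{v∈Σ₀}(δ₂ − δ₁) + e_p(E₂) − e_p(E₁)`.
Mechanism: both sides equal `log_p #(S^{Σ₀}_{E_i[p^∞]}(ℚ_∞) ⊓ H¹[p])` (K-B2/K-C2 at `p ‖ N`; gen 11
at good ordinary), and these orders agree by the gens 8–9 kernel transfer
`GreenbergVatsalTorsionInvariants.natCard_gvSelmer_inf_torsion_eq_of_inertia` (GV p. 27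
"independent of `i`") for the Tate data (`htriv`, `hgen` discharged, K-B1) resp. Greenberg's datum.
Inputs that are NOT tree theorems: A40/A41 (Tate uniformisation), GV (5)–(7) at `p ‖ N`
(`lambda_nonPrimitive_eq_add_sum_delta_multiplicative`), GV Prop. (2.5)/p. 25
(`datumSelmer_divisible_of_finite_torsionBy`), GV p. 15 (`datumStrictSelmer_lt_datumSelmer_of_split`),
and for a good-ordinary member A111 (`imKummer_ge_greenbergCondition_at_p`), A115
(`lambda_nonPrimitive_eq_add_sum_delta`), A116 (`divisible_nonPrimitiveSelmerInfty_of_mu_eq_zero`);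
Kato's cotorsion as the hypotheses `D_i.IsTorsion`.

References: Greenberg–Vatsal 2000 Thm. (1.4), §1 (5)–(7), pp. 14–15, §2 Prop. (2.1), (2.5), (2.8),
pp. 20, 25–27.
-/

noncomputable section

open scoped Classical AddSubgroup

universe u

namespace Summit.BirchSwinnertonDyer.Rank1Residual.X2.CongruentLambdaShiftMultiplicative

open NumberField IsDedekindDomain Field Literature.NumberTheory.GaloisRepresentations
  Literature.NumberTheory.EllipticCurves Literature.NumberTheory.EllipticCurves.GreenbergSelmer
  Literature.NumberTheory.EllipticCurves.GreenbergVatsal2000 IsDedekindDomain.HeightOneSpectrum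
  Summit.BirchSwinnertonDyer.Rank1Residual.X2.TorsionComparison
  Summit.BirchSwinnertonDyer.Rank1Residual.X2.GreenbergVatsalTorsion
  Summit.BirchSwinnertonDyer.Rank1Residual.X2.GreenbergVatsalTorsionCurve
  Summit.BirchSwinnertonDyer.Rank1Residual.X2.GreenbergVatsalTorsionInvariants
  Summit.BirchSwinnertonDyer.Rank1Residual.X2.GreenbergVatsalReductionDatum
  Summit.BirchSwinnertonDyer.Rank1Residual.X2.GreenbergVatsalReductionDatumLine
  Summit.BirchSwinnertonDyer.Rank1Residual.X2.GreenbergVatsalTransferCurve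
  Summit.BirchSwinnertonDyer.Rank1Residual.X2.GreenbergVatsalTransferMultiplicative
  Summit.BirchSwinnertonDyer.Rank1Residual.X2.CongruentLambdaShiftDerived
  Summit.BirchSwinnertonDyer.Rank1Residual.X2.GreenbergSelmerCountMultiplicative

open WeierstrassCurve (minimalDiscriminantInt)

variable (W₁ W₂ : WeierstrassCurve ℚ) [W₁.IsElliptic] [W₁.IsGloballyMinimal] [W₂.IsElliptic]
  [W₂.IsGloballyMinimal] {p : ℕ} [hp : Fact p.Prime] {κ : ZpExtension ℚ p}
  {γ : absoluteGaloisGroup ℚ} (S₀ : Finset (HeightOneSpectrum (𝓞 ℚ)))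

/-! ## §1. The kernel transfer for given data (mixed and mult–mult) -/

/-- The transfer `#(S^{Σ₀}_{E₁[p^∞]} ⊓ H¹[p]) = #(S^{Σ₀}_{E₂[p^∞]} ⊓ H¹[p])` for a MIXED pair with GIVEN
Tate data `L₁` (`htriv`, `hgen`) of the multiplicative member and Greenberg's datum of the good
ordinary member (gens 8–9 kernel transfer; GV p. 27 "independent of `i`").
[cite: GreenbergVatsal2000, §2 Prop. (2.8) and pp. 26–27] -/
theorem natCard_eq_mixed (hT : Silverman1994_thmV53_corV54_tateUniformisation.{0}) (hp2 : p ≠ 2)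
    (hmult₁ : W₁.HasMultiplicativeReductionAtPrime p)
    (hgood₂ : W₂.HasGoodReductionAtPrime p) (hord₂ : ¬ (p : ℤ) ∣ W₂.frobeniusTrace p)
    (hκ : κ.IsCyclotomic)
    (hS₁ : ∀ v : HeightOneSpectrum (𝓞 ℚ), v ∉ S₀ → ((p : ℕ) : 𝓞 ℚ) ∉ v.asIdeal →
      W₁.HasGoodReductionAt v)
    (hS₂ : ∀ v : HeightOneSpectrum (𝓞 ℚ), v ∉ S₀ → ((p : ℕ) : 𝓞 ℚ) ∉ v.asIdeal →
      W₂.HasGoodReductionAt v)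
    (hiso : X1.CongruenceTransfer.TorsionIso W₁ W₂ p)
    (L₁ : Data ℚ (W₁.geomPrimaryTorsion p) p)
    (htriv₁ : ∀ (v : HeightOneSpectrum (𝓞 ℚ)) (hv : ((p : ℕ) : 𝓞 ℚ) ∈ v.asIdeal),
      ∀ x ∈ inertia v, ∀ m : W₁.geomPrimaryTorsion p, x • m - m ∈ (L₁ v hv).plus)
    (hgen₁ : ∀ (v : HeightOneSpectrum (𝓞 ℚ)) (hv : ((p : ℕ) : 𝓞 ℚ) ∈ v.asIdeal),
      ∀ c ∈ (torsionData L₁ p v hv).plus, ∃ τ ∈ inertia v,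
        ∃ c' ∈ (torsionData L₁ p v hv).plus, τ • c' - c' = c) :
    Nat.card ↥(gvSelmerInfty κ (W₁.geomPrimaryTorsion p) L₁ (↑S₀ : Set (HeightOneSpectrum (𝓞 ℚ))) ⊓
        (subgroupH1 κ.kerSubgroup (W₁.geomPrimaryTorsion p))[(p : ℤ)]) =
      Nat.card ↥(gvSelmerInfty κ (W₂.geomPrimaryTorsion p)
        (reductionData W₂ p (W₂.not_dvd_minimalDiscriminantInt_of_hasGoodReductionAtPrime' p hgood₂))
        (↑S₀ : Set (HeightOneSpectrum (𝓞 ℚ))) ⊓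
        (subgroupH1 κ.kerSubgroup (W₂.geomPrimaryTorsion p))[(p : ℤ)]) := by
  obtain ⟨θ, hθ⟩ := GreenbergVatsalTransferCurve.exists_equiv_of_torsionIso hiso
  haveI : Finite (invariants κ.kerSubgroup (W₁.geomPrimaryTorsion p)) :=
    finite_fixedPoints_kerSubgroup_of_hasMultiplicativeReductionAtPrime W₁ p hT hp2 hmult₁ κ hκ
  haveI : Finite (invariants κ.kerSubgroup (W₂.geomPrimaryTorsion p)) :=
    W₂.finite_fixedPoints_kerSubgroup_geomPrimaryTorsion_of_ordinary κ hp2 hgood₂ hord₂ hκ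
  exact natCard_gvSelmer_inf_torsion_eq_of_inertia κ.kerSubgroup
    (W₁.geomPrimaryTorsion p) (W₂.geomPrimaryTorsion p) p L₁ _ (↑S₀ : Set (HeightOneSpectrum (𝓞 ℚ)))
    p (continuous_smul_curve W₁ p) (continuous_smul_curve W₂ p) (divisible_curve W₁ p)
    (divisible_curve W₂ p) (unramified_outside W₁ p _ hS₁) (unramified_outside W₂ p _ hS₂) htriv₁
    (reductionData_htriv W₂ p _) hgen₁ (reductionData_hgen W₂ p hp2 _ hord₂) θ hθ

/-- The transfer for a MULT–MULT pair with given Tate data `L₁`, `L₂`.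
[cite: GreenbergVatsal2000, §2 Prop. (2.8) and pp. 26–27] -/
theorem natCard_eq_mult (hT : Silverman1994_thmV53_corV54_tateUniformisation.{0}) (hp2 : p ≠ 2)
    (hmult₁ : W₁.HasMultiplicativeReductionAtPrime p) (hmult₂ : W₂.HasMultiplicativeReductionAtPrime p)
    (hκ : κ.IsCyclotomic)
    (hS₁ : ∀ v : HeightOneSpectrum (𝓞 ℚ), v ∉ S₀ → ((p : ℕ) : 𝓞 ℚ) ∉ v.asIdeal →
      W₁.HasGoodReductionAt v)
    (hS₂ : ∀ v : HeightOneSpectrum (𝓞 ℚ), v ∉ S₀ → ((p : ℕ) : 𝓞 ℚ) ∉ v.asIdeal →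
      W₂.HasGoodReductionAt v)
    (hiso : X1.CongruenceTransfer.TorsionIso W₁ W₂ p)
    (L₁ : Data ℚ (W₁.geomPrimaryTorsion p) p) (L₂ : Data ℚ (W₂.geomPrimaryTorsion p) p)
    (htriv₁ : ∀ (v : HeightOneSpectrum (𝓞 ℚ)) (hv : ((p : ℕ) : 𝓞 ℚ) ∈ v.asIdeal),
      ∀ x ∈ inertia v, ∀ m : W₁.geomPrimaryTorsion p, x • m - m ∈ (L₁ v hv).plus)
    (htriv₂ : ∀ (v : HeightOneSpectrum (𝓞 ℚ)) (hv : ((p : ℕ) : 𝓞 ℚ) ∈ v.asIdeal),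
      ∀ x ∈ inertia v, ∀ m : W₂.geomPrimaryTorsion p, x • m - m ∈ (L₂ v hv).plus)
    (hgen₁ : ∀ (v : HeightOneSpectrum (𝓞 ℚ)) (hv : ((p : ℕ) : 𝓞 ℚ) ∈ v.asIdeal),
      ∀ c ∈ (torsionData L₁ p v hv).plus, ∃ τ ∈ inertia v,
        ∃ c' ∈ (torsionData L₁ p v hv).plus, τ • c' - c' = c)
    (hgen₂ : ∀ (v : HeightOneSpectrum (𝓞 ℚ)) (hv : ((p : ℕ) : 𝓞 ℚ) ∈ v.asIdeal),
      ∀ c ∈ (torsionData L₂ p v hv).plus, ∃ τ ∈ inertia v,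
        ∃ c' ∈ (torsionData L₂ p v hv).plus, τ • c' - c' = c) :
    Nat.card ↥(gvSelmerInfty κ (W₁.geomPrimaryTorsion p) L₁ (↑S₀ : Set (HeightOneSpectrum (𝓞 ℚ))) ⊓
        (subgroupH1 κ.kerSubgroup (W₁.geomPrimaryTorsion p))[(p : ℤ)]) =
      Nat.card ↥(gvSelmerInfty κ (W₂.geomPrimaryTorsion p) L₂ (↑S₀ : Set (HeightOneSpectrum (𝓞 ℚ))) ⊓
        (subgroupH1 κ.kerSubgroup (W₂.geomPrimaryTorsion p))[(p : ℤ)]) := by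
  obtain ⟨θ, hθ⟩ := GreenbergVatsalTransferCurve.exists_equiv_of_torsionIso hiso
  haveI : Finite (invariants κ.kerSubgroup (W₁.geomPrimaryTorsion p)) :=
    finite_fixedPoints_kerSubgroup_of_hasMultiplicativeReductionAtPrime W₁ p hT hp2 hmult₁ κ hκ
  haveI : Finite (invariants κ.kerSubgroup (W₂.geomPrimaryTorsion p)) :=
    finite_fixedPoints_kerSubgroup_of_hasMultiplicativeReductionAtPrime W₂ p hT hp2 hmult₂ κ hκ
  exact natCard_gvSelmer_inf_torsion_eq_of_inertia κ.kerSubgroup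
    (W₁.geomPrimaryTorsion p) (W₂.geomPrimaryTorsion p) p L₁ L₂ (↑S₀ : Set (HeightOneSpectrum (𝓞 ℚ)))
    p (continuous_smul_curve W₁ p) (continuous_smul_curve W₂ p) (divisible_curve W₁ p)
    (divisible_curve W₂ p) (unramified_outside W₁ p _ hS₁) (unramified_outside W₂ p _ hS₂) htriv₁
    htriv₂ hgen₁ hgen₂ θ hθ

/-! ## §2. The `μ`-transfer (GV p. 27) -/

/-- **MIXED pair, `μ(E₂) = 0` (good ordinary) ⇒ `μ(E₁) = 0` (multiplicative).**
[cite: GreenbergVatsal2000, Thm. (1.4), §2 Prop. (2.8) and p. 27] -/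
theorem mu_eq_zero_mult_of_goodOrd
    (hT : Silverman1994_thmV53_corV54_tateUniformisation.{0})
    (hT' : Silverman1994_thmV53_tateUniformisation.{0})
    (hAm : lambda_nonPrimitive_eq_add_sum_delta_multiplicative)
    (hGV : imKummer_ge_greenbergCondition_at_p) (hA : lambda_nonPrimitive_eq_add_sum_delta)
    (hB : divisible_nonPrimitiveSelmerInfty_of_mu_eq_zero)
    (hp2 : p ≠ 2) (hmult₁ : W₁.HasMultiplicativeReductionAtPrime p)
    (hgood₂ : W₂.HasGoodReductionAtPrime p) (hord₂ : ¬ (p : ℤ) ∣ W₂.frobeniusTrace p)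
    (hκ : κ.IsCyclotomic) (hγ : κ.IsTopGenerator γ)
    (hS₀ : ∀ v ∈ S₀, ((p : ℕ) : 𝓞 ℚ) ∉ v.asIdeal)
    (hS₁ : ∀ v : HeightOneSpectrum (𝓞 ℚ), v ∉ S₀ → ((p : ℕ) : 𝓞 ℚ) ∉ v.asIdeal →
      W₁.HasGoodReductionAt v)
    (hS₂ : ∀ v : HeightOneSpectrum (𝓞 ℚ), v ∉ S₀ → ((p : ℕ) : 𝓞 ℚ) ∉ v.asIdeal →
      W₂.HasGoodReductionAt v)
    (hiso : X1.CongruenceTransfer.TorsionIso W₁ W₂ p)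
    (D₁ : W₁.SelmerDualData κ γ) (D₂ : W₂.SelmerDualData κ γ)
    [Module.Finite (IwasawaAlgebra p) D₁.X] [Module.Finite (IwasawaAlgebra p) D₂.X]
    (hX₁ : D₁.IsTorsion) (hX₂ : D₂.IsTorsion) (hμ₂ : D₂.mu = 0) : D₁.mu = 0 := by
  obtain ⟨L₁, htriv₁, hgen₁, hle₁⟩ :=
    exists_data_le_multiplicative W₁ p κ S₀ hT hT' hκ hp2 hmult₁ hS₀ hS₁
  have h₂ := natCard_gvSelmerInfty_inf_torsionBy_eq_pow W₂ S₀ hGV hA hB hp2 hgood₂ hord₂ hκ hγ hS₀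
    hS₂ D₂ hX₂ hμ₂ (W₂.not_dvd_minimalDiscriminantInt_of_hasGoodReductionAtPrime' p hgood₂)
  have ht := natCard_eq_mixed W₁ W₂ S₀ hT hp2 hmult₁ hgood₂ hord₂ hκ hS₁ hS₂ hiso L₁ htriv₁ hgen₁
  refine mu_eq_zero_of_natCard_ne_zero_multiplicative W₁ p κ S₀ hAm hκ hγ hp2 hmult₁ hS₀ L₁ hle₁
    ?_ D₁ hX₁
  rw [ht, h₂]; exact pow_ne_zero _ hp.out.ne_zero

/-- **MIXED pair, `μ(E₁) = 0` (multiplicative) ⇒ `μ(E₂) = 0` (good ordinary).**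
[cite: GreenbergVatsal2000, Thm. (1.4), §2 Prop. (2.8) and p. 27] -/
theorem mu_eq_zero_goodOrd_of_mult
    (hT : Silverman1994_thmV53_corV54_tateUniformisation.{0})
    (hT' : Silverman1994_thmV53_tateUniformisation.{0})
    (hAm : lambda_nonPrimitive_eq_add_sum_delta_multiplicative)
    (hBm : datumSelmer_divisible_of_finite_torsionBy) (hF : datumStrictSelmer_lt_datumSelmer_of_split)
    (hGV : imKummer_ge_greenbergCondition_at_p) (hA : lambda_nonPrimitive_eq_add_sum_delta)
    (hp2 : p ≠ 2) (hmult₁ : W₁.HasMultiplicativeReductionAtPrime p)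
    (hgood₂ : W₂.HasGoodReductionAtPrime p) (hord₂ : ¬ (p : ℤ) ∣ W₂.frobeniusTrace p)
    (hκ : κ.IsCyclotomic) (hγ : κ.IsTopGenerator γ)
    (hS₀ : ∀ v ∈ S₀, ((p : ℕ) : 𝓞 ℚ) ∉ v.asIdeal)
    (hS₁ : ∀ v : HeightOneSpectrum (𝓞 ℚ), v ∉ S₀ → ((p : ℕ) : 𝓞 ℚ) ∉ v.asIdeal →
      W₁.HasGoodReductionAt v)
    (hS₂ : ∀ v : HeightOneSpectrum (𝓞 ℚ), v ∉ S₀ → ((p : ℕ) : 𝓞 ℚ) ∉ v.asIdeal →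
      W₂.HasGoodReductionAt v)
    (hiso : X1.CongruenceTransfer.TorsionIso W₁ W₂ p)
    (D₁ : W₁.SelmerDualData κ γ) (D₂ : W₂.SelmerDualData κ γ)
    [Module.Finite (IwasawaAlgebra p) D₁.X] [Module.Finite (IwasawaAlgebra p) D₂.X]
    (hX₁ : D₁.IsTorsion) (hX₂ : D₂.IsTorsion) (hμ₁ : D₁.mu = 0) : D₂.mu = 0 := by
  obtain ⟨L₁, htriv₁, hgen₁, -, h₁⟩ := exists_data_natCard_eq_pow_multiplicative W₁ p κ S₀ hT hT'
    hAm hBm hF hκ hγ hp2 hmult₁ hS₀ hS₁ D₁ hX₁ hμ₁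
  have ht := natCard_eq_mixed W₁ W₂ S₀ hT hp2 hmult₁ hgood₂ hord₂ hκ hS₁ hS₂ hiso L₁ htriv₁ hgen₁
  refine mu_eq_zero_of_natCard_ne_zero_goodOrdinary W₂ p κ S₀ hGV hA hκ hγ hp2 hgood₂ hord₂ hS₀ hS₂
    ?_ D₂ hX₂
  rw [← ht, h₁]; exact pow_ne_zero _ hp.out.ne_zero

/-- **MULT–MULT pair, `μ(E₁) = 0` ⇒ `μ(E₂) = 0`.** [cite: GreenbergVatsal2000, Thm. (1.4), p. 27] -/
theorem mu_eq_zero_mult_of_mult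
    (hT : Silverman1994_thmV53_corV54_tateUniformisation.{0})
    (hT' : Silverman1994_thmV53_tateUniformisation.{0})
    (hAm : lambda_nonPrimitive_eq_add_sum_delta_multiplicative)
    (hBm : datumSelmer_divisible_of_finite_torsionBy) (hF : datumStrictSelmer_lt_datumSelmer_of_split)
    (hp2 : p ≠ 2) (hmult₁ : W₁.HasMultiplicativeReductionAtPrime p)
    (hmult₂ : W₂.HasMultiplicativeReductionAtPrime p)
    (hκ : κ.IsCyclotomic) (hγ : κ.IsTopGenerator γ)
    (hS₀ : ∀ v ∈ S₀, ((p : ℕ) : 𝓞 ℚ) ∉ v.asIdeal)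
    (hS₁ : ∀ v : HeightOneSpectrum (𝓞 ℚ), v ∉ S₀ → ((p : ℕ) : 𝓞 ℚ) ∉ v.asIdeal →
      W₁.HasGoodReductionAt v)
    (hS₂ : ∀ v : HeightOneSpectrum (𝓞 ℚ), v ∉ S₀ → ((p : ℕ) : 𝓞 ℚ) ∉ v.asIdeal →
      W₂.HasGoodReductionAt v)
    (hiso : X1.CongruenceTransfer.TorsionIso W₁ W₂ p)
    (D₁ : W₁.SelmerDualData κ γ) (D₂ : W₂.SelmerDualData κ γ)
    [Module.Finite (IwasawaAlgebra p) D₁.X] [Module.Finite (IwasawaAlgebra p) D₂.X]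
    (hX₁ : D₁.IsTorsion) (hX₂ : D₂.IsTorsion) (hμ₁ : D₁.mu = 0) : D₂.mu = 0 := by
  obtain ⟨L₁, htriv₁, hgen₁, -, h₁⟩ := exists_data_natCard_eq_pow_multiplicative W₁ p κ S₀ hT hT'
    hAm hBm hF hκ hγ hp2 hmult₁ hS₀ hS₁ D₁ hX₁ hμ₁
  obtain ⟨L₂, htriv₂, hgen₂, hle₂⟩ :=
    exists_data_le_multiplicative W₂ p κ S₀ hT hT' hκ hp2 hmult₂ hS₀ hS₂
  have ht := natCard_eq_mult W₁ W₂ S₀ hT hp2 hmult₁ hmult₂ hκ hS₁ hS₂ hiso L₁ L₂ htriv₁ htriv₂ hgen₁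
    hgen₂
  refine mu_eq_zero_of_natCard_ne_zero_multiplicative W₂ p κ S₀ hAm hκ hγ hp2 hmult₂ hS₀ L₂ hle₂
    ?_ D₂ hX₂
  rw [← ht, h₁]; exact pow_ne_zero _ hp.out.ne_zero

/-! ## §3. The `λ`-transfer with the trivial-zero shift -/

/-- **MIXED pair: `λ(E₁) + Σδ(E₁) + e_p(E₁) = λ(E₂) + Σδ(E₂)`** (`E₁` with `p ‖ N₁`, `E₂` good
ordinary, both `μ = 0`; `e_p(E₁) = 1` if split, `0` if non-split) — GV's congruence invariant
`Λ = λ + Σδ + e_p` is "independent of `i`". [cite: GreenbergVatsal2000, Thm. (1.4), pp. 14–15, 26–27] -/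
theorem lambda_add_eq_mult_goodOrd
    (hT : Silverman1994_thmV53_corV54_tateUniformisation.{0})
    (hT' : Silverman1994_thmV53_tateUniformisation.{0})
    (hAm : lambda_nonPrimitive_eq_add_sum_delta_multiplicative)
    (hBm : datumSelmer_divisible_of_finite_torsionBy) (hF : datumStrictSelmer_lt_datumSelmer_of_split)
    (hGV : imKummer_ge_greenbergCondition_at_p) (hA : lambda_nonPrimitive_eq_add_sum_delta)
    (hB : divisible_nonPrimitiveSelmerInfty_of_mu_eq_zero)
    (hp2 : p ≠ 2) (hmult₁ : W₁.HasMultiplicativeReductionAtPrime p)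
    (hgood₂ : W₂.HasGoodReductionAtPrime p) (hord₂ : ¬ (p : ℤ) ∣ W₂.frobeniusTrace p)
    (hκ : κ.IsCyclotomic) (hγ : κ.IsTopGenerator γ)
    (hS₀ : ∀ v ∈ S₀, ((p : ℕ) : 𝓞 ℚ) ∉ v.asIdeal)
    (hS₁ : ∀ v : HeightOneSpectrum (𝓞 ℚ), v ∉ S₀ → ((p : ℕ) : 𝓞 ℚ) ∉ v.asIdeal →
      W₁.HasGoodReductionAt v)
    (hS₂ : ∀ v : HeightOneSpectrum (𝓞 ℚ), v ∉ S₀ → ((p : ℕ) : 𝓞 ℚ) ∉ v.asIdeal →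
      W₂.HasGoodReductionAt v)
    (hiso : X1.CongruenceTransfer.TorsionIso W₁ W₂ p)
    (D₁ : W₁.SelmerDualData κ γ) (D₂ : W₂.SelmerDualData κ γ)
    [Module.Finite (IwasawaAlgebra p) D₁.X] [Module.Finite (IwasawaAlgebra p) D₂.X]
    (hX₁ : D₁.IsTorsion) (hX₂ : D₂.IsTorsion) (hμ₁ : D₁.mu = 0) (hμ₂ : D₂.mu = 0) :
    lambdaInvariant p D₁.X + ∑ v ∈ S₀, delta W₁ p v +
        (if W₁.HasSplitMultiplicativeReductionAtPrime p then 1 else 0) =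
      lambdaInvariant p D₂.X + ∑ v ∈ S₀, delta W₂ p v := by
  obtain ⟨L₁, htriv₁, hgen₁, -, h₁⟩ := exists_data_natCard_eq_pow_multiplicative W₁ p κ S₀ hT hT'
    hAm hBm hF hκ hγ hp2 hmult₁ hS₀ hS₁ D₁ hX₁ hμ₁
  have h₂ := natCard_gvSelmerInfty_inf_torsionBy_eq_pow W₂ S₀ hGV hA hB hp2 hgood₂ hord₂ hκ hγ hS₀
    hS₂ D₂ hX₂ hμ₂ (W₂.not_dvd_minimalDiscriminantInt_of_hasGoodReductionAtPrime' p hgood₂)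
  have ht := natCard_eq_mixed W₁ W₂ S₀ hT hp2 hmult₁ hgood₂ hord₂ hκ hS₁ hS₂ hiso L₁ htriv₁ hgen₁
  rw [h₁, h₂] at ht
  exact Nat.pow_right_injective hp.out.two_le ht

/-- **MULT–MULT pair: `λ(E₁) + Σδ(E₁) + e_p(E₁) = λ(E₂) + Σδ(E₂) + e_p(E₂)`** (both `p ‖ N_i`, both
`μ = 0`). [cite: GreenbergVatsal2000, Thm. (1.4), pp. 14–15, 26–27] -/
theorem lambda_add_eq_mult_mult
    (hT : Silverman1994_thmV53_corV54_tateUniformisation.{0})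
    (hT' : Silverman1994_thmV53_tateUniformisation.{0})
    (hAm : lambda_nonPrimitive_eq_add_sum_delta_multiplicative)
    (hBm : datumSelmer_divisible_of_finite_torsionBy) (hF : datumStrictSelmer_lt_datumSelmer_of_split)
    (hp2 : p ≠ 2) (hmult₁ : W₁.HasMultiplicativeReductionAtPrime p)
    (hmult₂ : W₂.HasMultiplicativeReductionAtPrime p)
    (hκ : κ.IsCyclotomic) (hγ : κ.IsTopGenerator γ)
    (hS₀ : ∀ v ∈ S₀, ((p : ℕ) : 𝓞 ℚ) ∉ v.asIdeal)
    (hS₁ : ∀ v : HeightOneSpectrum (𝓞 ℚ), v ∉ S₀ → ((p : ℕ) : 𝓞 ℚ) ∉ v.asIdeal →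
      W₁.HasGoodReductionAt v)
    (hS₂ : ∀ v : HeightOneSpectrum (𝓞 ℚ), v ∉ S₀ → ((p : ℕ) : 𝓞 ℚ) ∉ v.asIdeal →
      W₂.HasGoodReductionAt v)
    (hiso : X1.CongruenceTransfer.TorsionIso W₁ W₂ p)
    (D₁ : W₁.SelmerDualData κ γ) (D₂ : W₂.SelmerDualData κ γ)
    [Module.Finite (IwasawaAlgebra p) D₁.X] [Module.Finite (IwasawaAlgebra p) D₂.X]
    (hX₁ : D₁.IsTorsion) (hX₂ : D₂.IsTorsion) (hμ₁ : D₁.mu = 0) (hμ₂ : D₂.mu = 0) :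
    lambdaInvariant p D₁.X + ∑ v ∈ S₀, delta W₁ p v +
        (if W₁.HasSplitMultiplicativeReductionAtPrime p then 1 else 0) =
      lambdaInvariant p D₂.X + ∑ v ∈ S₀, delta W₂ p v +
        (if W₂.HasSplitMultiplicativeReductionAtPrime p then 1 else 0) := by
  obtain ⟨L₁, htriv₁, hgen₁, -, h₁⟩ := exists_data_natCard_eq_pow_multiplicative W₁ p κ S₀ hT hT'
    hAm hBm hF hκ hγ hp2 hmult₁ hS₀ hS₁ D₁ hX₁ hμ₁
  obtain ⟨L₂, htriv₂, hgen₂, -, h₂⟩ := exists_data_natCard_eq_pow_multiplicative W₂ p κ S₀ hT hT'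
    hAm hBm hF hκ hγ hp2 hmult₂ hS₀ hS₂ D₂ hX₂ hμ₂
  have ht := natCard_eq_mult W₁ W₂ S₀ hT hp2 hmult₁ hmult₂ hκ hS₁ hS₂ hiso L₁ L₂ htriv₁ htriv₂ hgen₁
    hgen₂
  rw [h₁, h₂] at ht
  exact Nat.pow_right_injective hp.out.two_le ht

/-! ## §4. `CongruentLambdaShift` for pairs with a multiplicative member -/

/-- **Route G's typed input DERIVED for a MIXED pair (multiplicative `E₁`, good ordinary `E₂`):
`CongruentLambdaShift W₁ W₂ p (Σ_{v∈Σ₀}(δ₂ − δ₁) − e_p(E₁))`**, i.e. for all cyclotomic data and all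
f.g. torsion dual data with `μ = 0`: `λ(D₁.X) = λ(D₂.X) + Σ(δ₂ − δ₁) − e_p(E₁)`.
[cite: GreenbergVatsal2000, Thm. (1.4), §1 (7), pp. 14–15, §2 pp. 26–27] -/
theorem congruentLambdaShift_mult_goodOrd_of_facts
    (hT : Silverman1994_thmV53_corV54_tateUniformisation.{0})
    (hT' : Silverman1994_thmV53_tateUniformisation.{0})
    (hAm : lambda_nonPrimitive_eq_add_sum_delta_multiplicative)
    (hBm : datumSelmer_divisible_of_finite_torsionBy) (hF : datumStrictSelmer_lt_datumSelmer_of_split)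
    (hGV : imKummer_ge_greenbergCondition_at_p) (hA : lambda_nonPrimitive_eq_add_sum_delta)
    (hB : divisible_nonPrimitiveSelmerInfty_of_mu_eq_zero)
    (hp2 : p ≠ 2) (hmult₁ : W₁.HasMultiplicativeReductionAtPrime p)
    (hgood₂ : W₂.HasGoodReductionAtPrime p) (hord₂ : ¬ (p : ℤ) ∣ W₂.frobeniusTrace p)
    (hS₀ : ∀ v ∈ S₀, ((p : ℕ) : 𝓞 ℚ) ∉ v.asIdeal)
    (hS₁ : ∀ v : HeightOneSpectrum (𝓞 ℚ), v ∉ S₀ → ((p : ℕ) : 𝓞 ℚ) ∉ v.asIdeal →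
      W₁.HasGoodReductionAt v)
    (hS₂ : ∀ v : HeightOneSpectrum (𝓞 ℚ), v ∉ S₀ → ((p : ℕ) : 𝓞 ℚ) ∉ v.asIdeal →
      W₂.HasGoodReductionAt v) :
    X1.CongruenceTransfer.CongruentLambdaShift W₁ W₂ p
      (∑ v ∈ S₀, ((delta W₂ p v : ℤ) - (delta W₁ p v : ℤ)) -
        (if W₁.HasSplitMultiplicativeReductionAtPrime p then 1 else 0)) := by
  intro hiso κ γ hκ hγ _hγ' D₁ D₂ _ _ hX₁ hX₂ hμ₁ hμ₂
  have h := lambda_add_eq_mult_goodOrd W₁ W₂ S₀ hT hT' hAm hBm hF hGV hA hB hp2 hmult₁ hgood₂ hord₂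
    hκ hγ hS₀ hS₁ hS₂ hiso D₁ D₂ hX₁ hX₂ hμ₁ hμ₂
  rw [Finset.sum_sub_distrib]
  have h' : ((lambdaInvariant p D₁.X + ∑ v ∈ S₀, delta W₁ p v +
      (if W₁.HasSplitMultiplicativeReductionAtPrime p then 1 else 0) : ℕ) : ℤ) =
      ((lambdaInvariant p D₂.X + ∑ v ∈ S₀, delta W₂ p v : ℕ) : ℤ) := by rw [h]
  push_cast at h'
  linarith

/-- **Route G's typed input DERIVED for a MIXED pair, the other way round (good ordinary `E₂` as the
curve of interest): `CongruentLambdaShift W₂ W₁ p (Σ_{v∈Σ₀}(δ₁ − δ₂) + e_p(E₁))`.**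
[cite: GreenbergVatsal2000, Thm. (1.4), §1 (7), pp. 14–15, §2 pp. 26–27] -/
theorem congruentLambdaShift_goodOrd_mult_of_facts
    (hT : Silverman1994_thmV53_corV54_tateUniformisation.{0})
    (hT' : Silverman1994_thmV53_tateUniformisation.{0})
    (hAm : lambda_nonPrimitive_eq_add_sum_delta_multiplicative)
    (hBm : datumSelmer_divisible_of_finite_torsionBy) (hF : datumStrictSelmer_lt_datumSelmer_of_split)
    (hGV : imKummer_ge_greenbergCondition_at_p) (hA : lambda_nonPrimitive_eq_add_sum_delta)
    (hB : divisible_nonPrimitiveSelmerInfty_of_mu_eq_zero)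
    (hp2 : p ≠ 2) (hmult₁ : W₁.HasMultiplicativeReductionAtPrime p)
    (hgood₂ : W₂.HasGoodReductionAtPrime p) (hord₂ : ¬ (p : ℤ) ∣ W₂.frobeniusTrace p)
    (hS₀ : ∀ v ∈ S₀, ((p : ℕ) : 𝓞 ℚ) ∉ v.asIdeal)
    (hS₁ : ∀ v : HeightOneSpectrum (𝓞 ℚ), v ∉ S₀ → ((p : ℕ) : 𝓞 ℚ) ∉ v.asIdeal →
      W₁.HasGoodReductionAt v)
    (hS₂ : ∀ v : HeightOneSpectrum (𝓞 ℚ), v ∉ S₀ → ((p : ℕ) : 𝓞 ℚ) ∉ v.asIdeal →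
      W₂.HasGoodReductionAt v) :
    X1.CongruenceTransfer.CongruentLambdaShift W₂ W₁ p
      (∑ v ∈ S₀, ((delta W₁ p v : ℤ) - (delta W₂ p v : ℤ)) +
        (if W₁.HasSplitMultiplicativeReductionAtPrime p then 1 else 0)) := by
  intro hiso κ γ hκ hγ _hγ' D₂ D₁ _ _ hX₂ hX₁ hμ₂ hμ₁
  have h := lambda_add_eq_mult_goodOrd W₁ W₂ S₀ hT hT' hAm hBm hF hGV hA hB hp2 hmult₁ hgood₂ hord₂
    hκ hγ hS₀ hS₁ hS₂ hiso.symm D₁ D₂ hX₁ hX₂ hμ₁ hμ₂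
  rw [Finset.sum_sub_distrib]
  have h' : ((lambdaInvariant p D₁.X + ∑ v ∈ S₀, delta W₁ p v +
      (if W₁.HasSplitMultiplicativeReductionAtPrime p then 1 else 0) : ℕ) : ℤ) =
      ((lambdaInvariant p D₂.X + ∑ v ∈ S₀, delta W₂ p v : ℕ) : ℤ) := by rw [h]
  push_cast at h'
  linarith

/-- **Route G's typed input DERIVED for a MULT–MULT pair:
`CongruentLambdaShift W₁ W₂ p (Σ_{v∈Σ₀}(δ₂ − δ₁) + e_p(E₂) − e_p(E₁))`.**
[cite: GreenbergVatsal2000, Thm. (1.4), §1 (7), pp. 14–15, §2 pp. 26–27] -/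
theorem congruentLambdaShift_mult_mult_of_facts
    (hT : Silverman1994_thmV53_corV54_tateUniformisation.{0})
    (hT' : Silverman1994_thmV53_tateUniformisation.{0})
    (hAm : lambda_nonPrimitive_eq_add_sum_delta_multiplicative)
    (hBm : datumSelmer_divisible_of_finite_torsionBy) (hF : datumStrictSelmer_lt_datumSelmer_of_split)
    (hp2 : p ≠ 2) (hmult₁ : W₁.HasMultiplicativeReductionAtPrime p)
    (hmult₂ : W₂.HasMultiplicativeReductionAtPrime p)
    (hS₀ : ∀ v ∈ S₀, ((p : ℕ) : 𝓞 ℚ) ∉ v.asIdeal)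
    (hS₁ : ∀ v : HeightOneSpectrum (𝓞 ℚ), v ∉ S₀ → ((p : ℕ) : 𝓞 ℚ) ∉ v.asIdeal →
      W₁.HasGoodReductionAt v)
    (hS₂ : ∀ v : HeightOneSpectrum (𝓞 ℚ), v ∉ S₀ → ((p : ℕ) : 𝓞 ℚ) ∉ v.asIdeal →
      W₂.HasGoodReductionAt v) :
    X1.CongruenceTransfer.CongruentLambdaShift W₁ W₂ p
      (∑ v ∈ S₀, ((delta W₂ p v : ℤ) - (delta W₁ p v : ℤ)) +
        (if W₂.HasSplitMultiplicativeReductionAtPrime p then 1 else 0) -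
        (if W₁.HasSplitMultiplicativeReductionAtPrime p then 1 else 0)) := by
  intro hiso κ γ hκ hγ _hγ' D₁ D₂ _ _ hX₁ hX₂ hμ₁ hμ₂
  have h := lambda_add_eq_mult_mult W₁ W₂ S₀ hT hT' hAm hBm hF hp2 hmult₁ hmult₂ hκ hγ hS₀ hS₁ hS₂
    hiso D₁ D₂ hX₁ hX₂ hμ₁ hμ₂
  rw [Finset.sum_sub_distrib]
  have h' : ((lambdaInvariant p D₁.X + ∑ v ∈ S₀, delta W₁ p v +
      (if W₁.HasSplitMultiplicativeReductionAtPrime p then 1 else 0) : ℕ) : ℤ) =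
      ((lambdaInvariant p D₂.X + ∑ v ∈ S₀, delta W₂ p v +
      (if W₂.HasSplitMultiplicativeReductionAtPrime p then 1 else 0) : ℕ) : ℤ) := by rw [h]
  push_cast at h'
  linarith

end Summit.BirchSwinnertonDyer.Rank1Residual.X2.CongruentLambdaShiftMultiplicative

end
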